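import Literature.NumberTheory.EllipticCurves.Kato2004.ZetaClassOnRankLeOneBranch
import Literature.NumberTheory.EllipticCurves.Kato2004.IwasawaCohomologyEulerSystemLiftComp
import Literature.NumberTheory.EllipticCurves.Kato2004.IntegralH1CorestrictionMackey
import Literature.NumberTheory.EllipticCurves.Kato2004.ValueGuardSatisfiableProofs
import Literature.NumberTheory.EllipticCurves.PAdicLFunctionMinusDenominatorsProofs
import Literature.NumberTheory.EllipticCurves.ModularSymbolsManinDrinfeldGeneralProofs
import Literature.NumberTheory.EllipticCurves.PAdicLFunctionProofs
import Literature.NumberTheory.EllipticCurves.NewformPeriodRatio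
import Literature.NumberTheory.GaloisRepresentations.CyclotomicCharacterSurjectiveProofs
import Mathlib.GroupTheory.Archimedean
import Literature.NumberTheory.EllipticCurves.Rank1Residual.Predicates
import HarnessLib

/-!
# Kato 2004 (Astérisque 295) read at the MEMBER lattice of a `𝒞₇` class: the realisation letters `F•`, `F•′`
# and the named print fact `kato2004_classCSeven_memberRealisationPrint` (cell `bsd-cm`, vote V-E2 / D962, ruling D973)

Topic `Literature/NumberTheory/EllipticCurves`, sub-directory `Kato2004` (namespace = path).  Seat `bsd-cm-prr-ty1` g32
(literature-prover), the (E2)-PORT of crux `stmt-BirchSwinnertonDyer-19945` (K7r; line `Lines/kato_perrin_riou_zp.lean` v14, stub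
`stub_muFreeRealisedFamilySeven`).  This file VENDORS, in Literature vocabulary only (no `Summits` import):

* `MemberRealisationBody W p` / `MemberRealisation W p` — **`F•`**, the (E2) residual letter of ideator bsd-idea-20 g68
  (`Cruxes/EllipticUnitValueSevenOfGZK/RealisationAssemblySeven_g68.lean` §4, tree sha16 d2c3fb8381c0379f, l.744–797) VERBATIM:
  Kato's value-pinned family REALISED for `(W, p)` with defined Tate-normalised values, every admissible gauge, the Manin minus
  generator `q⁻`, the period ratio `ϖ`, and the member inequality (R3c) `0 ≤ v_p(ϖ/(q·q⁻))`.  `Prop` shapes, nothing asserted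
  (they are the TYPE of the open hypothesis `hR3c` of the Summits-side glue, ruling D973 (b)).
* `MemberRealisationPrintBody W p` / `MemberRealisationPrint W p` — **`F•′`**, the same letter WITHOUT (R3c): exactly the printed
  clauses (R0) (R1) (R2) (R3a) (R3b) (critic idea-crit-15 V#22cv clause map, cell INBOX l.351–352).
* THE NAMED PRINT FACT `kato2004_classCSeven_memberRealisationPrint : Prop` — **`F•₇′`**: every curve of the class `𝒞₇` (CM by
  `ℚ(√−7)`, analytic rank `1`, good ordinary at `2`, bad primes `≠ 7` split — the Summits predicate `X12.ClassCSeven` UNFOLDED into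
  the Literature predicates `Good` / `GoodOrd` / `CMSplit` / `cmFieldDiscrOfJ` of `Rank1Residual/Predicates.lean`; the Summits glue
  recovers the `X12.ClassCSeven` form by `Iff.rfl`) has a globally minimal `ℚ`-ISOGENOUS member `W′` with
  `MemberRealisationPrint W′ 7`.  WHY `∃ W′ ~ W` and not `∀ W`: Kato's construction and Thm. 12.5 are stated for the lattice
  `T = V_{O_λ}(f)(1)` (§13.12, p. 231: «Let `T = V_{O_λ}(f)` … By Lemma 13.10, we have `Z ⊂ ℨ(f,T)` … `ℨ(f,T)/Z` is a finite
  group»; Wuthrich 2014 p. 391: «let `Z` be the Λ-submodule of `H¹(T)` generated by all `_{c,d}z_{pⁿ}(α)`, `_{c,d}z_{pⁿ}(aA)` where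
  `c, d, a, A` and `α` run over…»), and that lattice is `T_pW_K` for ONE member `W_K` of the isogeny class (tree THEOREM
  `WeierstrassCurve.exists_isIsogenous_isGloballyMinimal_tateModule_equiv_of_stableRationalLattice`); off the member the integrality
  can fail (Wuthrich p. 394: semistability «can not be dropped»; the constant `C`).  No `_holds` (SIZE XL: Kato Ch. II–III at an
  additive CM prime); debt +1, authorised by the cell vote D962 and the pen's word D973.

LITERAL-MATCH RISK recorded (critic n2, g68 memo §4 (i)): the tree's `DefinedExpStarBody` fixes a Tate-normalised coordinate and
the sign `ε = −` of the homological (minus-symbol / plus-period) convention; Kato's (12.5.1) normalisation is matched up to that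
convention.  HONEST LABEL: four `Prop` letters + ONE named fact; nothing is proved here; the (E2) stub, crux 19945,
`X12.CMRamifiedSeven` and BSD stay OPEN; no instance, no notation, no `sorry`.

## References (pages verified on the held texts `paper:doi-10-24033-ast-639`, `paper:doi-10-4171-dm-450`)

K. Kato, *p-adic Hodge theory and values of zeta functions of modular forms*, Astérisque 295 (2004): (8.1.3) p. 180, §8.2 pp. 180–184,
Prop. 8.12 p. 186, Thm. 9.7 p. 189, Thm. 12.4 p. 220, Thm. 12.5 (1) p. 221, Ex. 13.3 p. 225, §13.9 p. 229, Lemma 13.10 (1) p. 230,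
§13.12–13.14 pp. 231–234 [Kato2004Asterisque]; C. Wuthrich, *On the integrality of modular symbols and Kato's Euler system for elliptic
curves*, Doc. Math. 19 (2014) 381–402, pp. 391, 394 [Wuthrich2014]; S. Bloch, K. Kato, *L-functions and Tamagawa numbers of
motives* (1990) Prop. 3.8 [BlochKato1990]; Ju. I. Manin, *Parabolic points and zeta functions of modular curves* (1972) Thm. 1.6, Cor. 3.6
[Manin1972]; B. Edixhoven, *On the Manin constants of modular elliptic curves* (1991) §1 [EdixhovenManin1991].
-/

set_option autoImplicit false

noncomputable section

open scoped BigOperators NumberField TensorProduct Classical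
open Field IsDedekindDomain NumberField CongruenceSubgroup ValuativeRel
open Literature.NumberTheory.GaloisRepresentations
open Literature.NumberTheory.GaloisRepresentations.PeriodRingData
open Literature.NumberTheory.GaloisRepresentations.IsNonarchimedeanLocalField
open Literature.NumberTheory.PAdicHodge
open Literature.NumberTheory.EllipticCurves Literature.NumberTheory.EllipticCurves.ModularForms
open Literature.NumberTheory.AdelicBaseChange Literature.NumberTheory.Automorphic
open Literature.NumberTheory.EllipticCurves.Kato2004.EulerSystemValues Rat.HeightOneSpectrum
open Literature.NumberTheory.EllipticCurves.Rank1Residual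
open WeierstrassCurve

namespace Literature.NumberTheory.EllipticCurves.Kato2004

/-! ## §1 `F•`: the (E2) residual letter of g68, VERBATIM (with the member inequality (R3c)) -/

set_option backward.isDefEq.respectTransparency false in
/-- **`F•` = `MemberRealisationBody W p`** — the (E2) RESIDUAL as a statement about `(W, p)` ALONE.  The local-field `letI` block,
the binders `N, f, IsNewformOf W f, ι, q, Λ` and clauses (R0) = (A0), (R1) = (A1) ∧ (A2) are VERBATIM those of
`Kato2004.HasMuFreeRealisedZetaFamilyBody` (minus `hp : p ≠ 2`, which only the lift needs); (R2) is the (A3)-family `∃ z x, ZetaBody …`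
for EVERY admissible gauge `(c, d₁, a, A, d′)` under the body's own guards [(8.1.3): Kato's `_{c,d}z_m^{(p)}` exist for all `c, d`
with `(c, 6p) = (d, 6pN) = 1`; Ex. 13.3 / (13.1.1): every `ξ = a(A)`]; (R3) is the body's scalar block with the Manin coordinates,
the Galois elements, `e` and the μ-clause REMOVED: `q⁻ > 0` generating the minus lattice (a theorem: §1), a period ratio
`ϖ ∈ ℚˣ` with `Ω⁺_f = ϖ·Ω_W` (a consequence of catalogued facts: `NewformPeriodRatio`), and the ONE member-dependent inequality
`0 ≤ v_p(ϖ/(q·q⁻))` (g67: `= 0` at Kato's member `W_K`; `< 0` off it).  What it SAYS in print terms: «for the curve `W` itself (not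
just some lattice `T ⊂ V_pW`), Kato's Euler system of (8.1.3)/Ex. 13.3 with values in `H¹(ℤ[1/p, μ_m], T_pW)` exists in every
admissible gauge, its values are the dual exponential `exp*` in a Tate-normalised coordinate with a RATIONAL non-zero constant `q`
(Thm. 9.7, 12.5 (1)), and `v_p(Ω⁺_f/(Ω_W·q·q⁻)) ≥ 0`».  A `Prop`; a HYPOTHESIS shape; nothing asserted.
[cite: Kato2004Asterisque, (8.1.3) (p. 180), Prop. 8.12 (p. 186), Thm. 9.7 (p. 189), Thm. 12.5 (1) (p. 221), Ex. 13.3 (p. 225), §13.12–13.14 (pp. 231–234)]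
[cite: BlochKato1990, Prop. 3.8 (p. 354)] [cite: Manin1972, Thm. 1.6 and Cor. 3.6] -/
def MemberRealisationBody (W : WeierstrassCurve ℚ) [W.IsElliptic] [W.IsGloballyMinimal] (p : ℕ) [Fact p.Prime]
    [ContinuousSMul ℤ_[p] (W.tateModule p)] [Module.Free ℤ_[p] (W.tateModule p)]
    [Module.Finite ℤ_[p] (W.tateModule p)] : Prop :=
  letI ρT := restrictedTateRep W (NumberField.Place.Completion (Sum.inr ((Rat.HeightOneSpectrum.primesEquiv (R := 𝓞 ℚ)).symm ⟨p, Fact.out⟩) : NumberField.Place ℚ)) p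
  letI : ValuativeRel (NumberField.Place.Completion (Sum.inr ((Rat.HeightOneSpectrum.primesEquiv (R := 𝓞 ℚ)).symm ⟨p, Fact.out⟩) : NumberField.Place ℚ)) :=
    inferInstanceAs (ValuativeRel (((Rat.HeightOneSpectrum.primesEquiv (R := 𝓞 ℚ)).symm ⟨p, Fact.out⟩).adicCompletion ℚ))
  letI : TopologicalSpace (NumberField.Place.Completion (Sum.inr ((Rat.HeightOneSpectrum.primesEquiv (R := 𝓞 ℚ)).symm ⟨p, Fact.out⟩) : NumberField.Place ℚ)) :=
    inferInstanceAs (TopologicalSpace (((Rat.HeightOneSpectrum.primesEquiv (R := 𝓞 ℚ)).symm ⟨p, Fact.out⟩).adicCompletion ℚ))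
  haveI : IsNonarchimedeanLocalField (NumberField.Place.Completion (Sum.inr ((Rat.HeightOneSpectrum.primesEquiv (R := 𝓞 ℚ)).symm ⟨p, Fact.out⟩) : NumberField.Place ℚ)) :=
    inferInstanceAs (IsNonarchimedeanLocalField (((Rat.HeightOneSpectrum.primesEquiv (R := 𝓞 ℚ)).symm ⟨p, Fact.out⟩).adicCompletion ℚ))
  haveI : CharZero (NumberField.Place.Completion (Sum.inr ((Rat.HeightOneSpectrum.primesEquiv (R := 𝓞 ℚ)).symm ⟨p, Fact.out⟩) : NumberField.Place ℚ)) := LocalField.charZero_adicCompletion ((Rat.HeightOneSpectrum.primesEquiv (R := 𝓞 ℚ)).symm ⟨p, Fact.out⟩)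
  letI : Algebra ℚ_[p] (NumberField.Place.Completion (Sum.inr ((Rat.HeightOneSpectrum.primesEquiv (R := 𝓞 ℚ)).symm ⟨p, Fact.out⟩) : NumberField.Place ℚ)) :=
    LocalField.adicCompletionPadicAlgebra ((Rat.HeightOneSpectrum.primesEquiv (R := 𝓞 ℚ)).symm ⟨p, Fact.out⟩) p ((natCast_mem_asIdeal_iff_eq_primesEquiv_symm _ (Fact.out : p.Prime)).mpr rfl)
  haveI : Fact (¬ IsUnit ((p : ℕ) : integerC (NumberField.Place.Completion (Sum.inr ((Rat.HeightOneSpectrum.primesEquiv (R := 𝓞 ℚ)).symm ⟨p, Fact.out⟩) : NumberField.Place ℚ)))) :=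
    ⟨not_isUnit_natCast_integerC (show valuation (NumberField.Place.Completion (Sum.inr ((Rat.HeightOneSpectrum.primesEquiv (R := 𝓞 ℚ)).symm ⟨p, Fact.out⟩) : NumberField.Place ℚ)) ((p : ℕ) : (NumberField.Place.Completion (Sum.inr ((Rat.HeightOneSpectrum.primesEquiv (R := 𝓞 ℚ)).symm ⟨p, Fact.out⟩) : NumberField.Place ℚ))) < 1 from LocalField.valuation_adicCompletion_natCast_lt_one ((Rat.HeightOneSpectrum.primesEquiv (R := 𝓞 ℚ)).symm ⟨p, Fact.out⟩) p ((natCast_mem_asIdeal_iff_eq_primesEquiv_symm _ (Fact.out : p.Prime)).mpr rfl))⟩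
  haveI := isAdicComplete_integerC_natCast (show valuation (NumberField.Place.Completion (Sum.inr ((Rat.HeightOneSpectrum.primesEquiv (R := 𝓞 ℚ)).symm ⟨p, Fact.out⟩) : NumberField.Place ℚ)) ((p : ℕ) : (NumberField.Place.Completion (Sum.inr ((Rat.HeightOneSpectrum.primesEquiv (R := 𝓞 ℚ)).symm ⟨p, Fact.out⟩) : NumberField.Place ℚ))) < 1 from LocalField.valuation_adicCompletion_natCast_lt_one ((Rat.HeightOneSpectrum.primesEquiv (R := 𝓞 ℚ)).symm ⟨p, Fact.out⟩) p ((natCast_mem_asIdeal_iff_eq_primesEquiv_symm _ (Fact.out : p.Prime)).mpr rfl))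
  -- the tree's `ℚ`-algebra structure on `ℚ_v` pinned, as in `AdmissibleZetaClassBody`
  letI : Algebra ℚ (NumberField.Place.Completion (Sum.inr ((Rat.HeightOneSpectrum.primesEquiv (R := 𝓞 ℚ)).symm ⟨p, Fact.out⟩) : NumberField.Place ℚ)) := NumberField.Place.instAlgebraCompletion (Sum.inr ((Rat.HeightOneSpectrum.primesEquiv (R := 𝓞 ℚ)).symm ⟨p, Fact.out⟩) : NumberField.Place ℚ)
  ∃ (N : ℕ) (_ : NeZero N) (f : CuspForm (Gamma0 N) 2) (_ : IsNewformOf W f)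
    (ι : (n : ℕ) → (CyclotomicField n ℚ →+* ℂ)) (q : ℚ)
    (Λ : ∀ (k : ℕ) (r : Finset (HeightOneSpectrum (𝓞 ℚ))),
      H1 (tateRep W p) (cycSubgroup p k r) →ₗ[ℤ_[p]] ℚ_[p] ⊗[ℚ] CyclotomicField (cycLevel p k r) ℚ),
    -- (R0) = (A0): the constant of the value law is non-zero (and rational: `q : ℚ`)
    q ≠ 0 ∧
    -- (R1) = (A1) ∧ (A2) VERBATIM: the value functional IS the dual exponential in a Tate-duality-normalised coordinate `d`
    (∃ d, DefinedExpStarBody W p f d ι ((q : ℚ) : ℝ) Λ ∧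
      ∀ a : (NumberField.Place.Completion (Sum.inr ((Rat.HeightOneSpectrum.primesEquiv (R := 𝓞 ℚ)).symm ⟨p, Fact.out⟩) : NumberField.Place ℚ)),
        (∃ η : contOneCocycles ρT.toTopRep, expStarCoord W (show valuation (NumberField.Place.Completion (Sum.inr ((Rat.HeightOneSpectrum.primesEquiv (R := 𝓞 ℚ)).symm ⟨p, Fact.out⟩) : NumberField.Place ℚ)) ((p : ℕ) : (NumberField.Place.Completion (Sum.inr ((Rat.HeightOneSpectrum.primesEquiv (R := 𝓞 ℚ)).symm ⟨p, Fact.out⟩) : NumberField.Place ℚ))) < 1 from LocalField.valuation_adicCompletion_natCast_lt_one ((Rat.HeightOneSpectrum.primesEquiv (R := 𝓞 ℚ)).symm ⟨p, Fact.out⟩) p ((natCast_mem_asIdeal_iff_eq_primesEquiv_symm _ (Fact.out : p.Prime)).mpr rfl)) d η = a) ↔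
          ∀ Q : (W.baseChange ℚ_[p]).toAffine.Point,
            ‖(Padic.adicCompletionEquiv (𝓞 ℚ) ⟨p, Fact.out⟩).symm
                (show ((Rat.HeightOneSpectrum.primesEquiv (R := 𝓞 ℚ)).symm ⟨p, Fact.out⟩).adicCompletion ℚ from a) * padicLogLocal W p Q‖ ≤ 1) ∧
    -- (R2) = (A3)-∀gauge: for EVERY admissible gauge, THE family with these values EXISTS
    (∀ (c d₁ a : ℤ) (A : ℕ) (d' : ℤ),
      0 < A → Int.gcd c (6 * p * A) = 1 → Int.gcd d₁ (6 * p * N) = 1 → (d₁ : ℤ) * d' ≡ 1 [ZMOD (A : ℤ)] →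
      ratCuspFactor f true c d₁ a A d' ≠ 0 →
        ∃ (z : ∀ (k : ℕ) (r : (cyclotomicLevelsRat p (badPlaces c d₁ A N)).Ideals),
            H1 (tateRep W p) ((cyclotomicLevelsRat p (badPlaces c d₁ A N)).level k r.1))
          (x : ∀ (k : ℕ) (r : (cyclotomicLevelsRat p (badPlaces c d₁ A N)).Ideals),
            CyclotomicField (cycLevel p k r.1) ℚ),
          ZetaBody W p f ι ((q : ℚ) : ℝ) Λ c d₁ a A z x) ∧
    -- (R3) = (A5′)-scalars without `n₁ … n₄`, `σ_c σ_{d₁} σ_ℓ`, `e`, and WITHOUT the μ-clause: `q⁻`, `ϖ`, and `0 ≤ v_p(ϖ/(q·q⁻))`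
    ∃ (qm perRatio : ℚ),
      0 < qm ∧ AddSubgroup.closure (Set.range (ratMinusSymbol f)) = AddSubgroup.zmultiples qm ∧
      perRatio ≠ 0 ∧ plusPeriod f = ((perRatio : ℚ) : ℝ) * W.realPeriodRat ∧
      0 ≤ padicValRat p (perRatio / (q * qm))


/-- `F•` CLOSED over the structure facts of `T_pW` (tree theorems `module_free/finite_tateModule_holds`), exactly as
`Kato2004.HasMuFreeRealisedZetaFamily` closes its body. [cite: Kato2004Asterisque, Thm. 12.5 (1) (p. 221)] -/
def MemberRealisation (W : WeierstrassCurve ℚ) [W.IsElliptic] [W.IsGloballyMinimal] (p : ℕ) [Fact p.Prime]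
    [ContinuousSMul ℤ_[p] (W.tateModule p)] : Prop :=
  letI : Module.Free ℤ_[p] (W.tateModule p) := W.module_free_tateModule_holds p
  letI : Module.Finite ℤ_[p] (W.tateModule p) := W.module_finite_tateModule_holds p
  MemberRealisationBody W p

/-! ## §2 `F•′`: the PRINT clauses only ((R3c) removed) -/

set_option backward.isDefEq.respectTransparency false in
/-- **`F•′` = `MemberRealisationPrintBody W p` — THE PRINT CLAUSES ONLY** (cell `bsd-cm` vote V-E2, D962, in split
form; ruling D973): `MemberRealisationBody W p` with its last conjunct (R3c) `0 ≤ v_p(ϖ/(q·q⁻))` REMOVED.  What remains is,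
clause by clause, printed by Kato at the MEMBER lattice `T = V_{O_λ}(f)(1)`: (R0) a rational constant `q ≠ 0` and (R1) the values
of the family ARE the dual exponential `exp*` in a Tate-normalised coordinate [Thm. 9.7 p. 189; Thm. 12.5 (1) p. 221: «There
exists a unique `F_λ`-linear map `V_{F_λ}(f) → H¹(V_{F_λ}(f)); γ ↦ z_γ^{(p)}` … the image … under `exp*` … belongs to
`S(f) ⊗ ℚ(ζ_{pⁿ})` … `per_f(x)^±` … `L_{(p)}(f, χ, r)`»; Bloch–Kato Prop. 3.8 for the duality `exp*_ω · log_ω`];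
(R2) for EVERY admissible gauge `(c, d₁, a, A, d′)` — `0 < A`, `(c, 6pA) = 1`, `(d₁, 6pN) = 1`, `d₁d′ ≡ 1 (mod A)`, cusp
factor `≠ 0` — the Euler system with these values EXISTS [(8.1.3) p. 180; Prop. 8.12 p. 186; Ex. 13.3 p. 225: «fix non-zero
integers `c, d` … `(c, 6pA) = 1` and `(d, 6pN) = 1` … Then `(z_m)_m` is an Euler system for `(T, F_λ, Ξ)`»]; (R3a) the Manin
minus lattice has a positive generator `q⁻` [Manin 1972 Cor. 3.6] and (R3b) `Ω⁺_f = ϖ·Ω_W` with `ϖ ∈ ℚˣ` [Edixhoven 1991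
§1; Carayol 1986] (both harmless: a theorem / a consequence of catalogued facts, kept for the letter).  A `Prop`; a HYPOTHESIS
shape; nothing asserted; the `letI` block is the body's own (local-field structure on `ℚ_v`, no global instance).
[cite: Kato2004Asterisque, (8.1.3) (p. 180), Prop. 8.12 (p. 186), Thm. 9.7 (p. 189), Thm. 12.5 (1) (p. 221), Ex. 13.3 (p. 225)]
[cite: BlochKato1990, Prop. 3.8 (p. 354)] [cite: Manin1972, Cor. 3.6] [cite: EdixhovenManin1991, §1] -/
def MemberRealisationPrintBody (W : WeierstrassCurve ℚ) [W.IsElliptic] [W.IsGloballyMinimal] (p : ℕ) [Fact p.Prime]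
    [ContinuousSMul ℤ_[p] (W.tateModule p)] [Module.Free ℤ_[p] (W.tateModule p)]
    [Module.Finite ℤ_[p] (W.tateModule p)] : Prop :=
  letI ρT := restrictedTateRep W (NumberField.Place.Completion (Sum.inr ((Rat.HeightOneSpectrum.primesEquiv (R := 𝓞 ℚ)).symm ⟨p, Fact.out⟩) : NumberField.Place ℚ)) p
  letI : ValuativeRel (NumberField.Place.Completion (Sum.inr ((Rat.HeightOneSpectrum.primesEquiv (R := 𝓞 ℚ)).symm ⟨p, Fact.out⟩) : NumberField.Place ℚ)) :=
    inferInstanceAs (ValuativeRel (((Rat.HeightOneSpectrum.primesEquiv (R := 𝓞 ℚ)).symm ⟨p, Fact.out⟩).adicCompletion ℚ))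
  letI : TopologicalSpace (NumberField.Place.Completion (Sum.inr ((Rat.HeightOneSpectrum.primesEquiv (R := 𝓞 ℚ)).symm ⟨p, Fact.out⟩) : NumberField.Place ℚ)) :=
    inferInstanceAs (TopologicalSpace (((Rat.HeightOneSpectrum.primesEquiv (R := 𝓞 ℚ)).symm ⟨p, Fact.out⟩).adicCompletion ℚ))
  haveI : IsNonarchimedeanLocalField (NumberField.Place.Completion (Sum.inr ((Rat.HeightOneSpectrum.primesEquiv (R := 𝓞 ℚ)).symm ⟨p, Fact.out⟩) : NumberField.Place ℚ)) :=
    inferInstanceAs (IsNonarchimedeanLocalField (((Rat.HeightOneSpectrum.primesEquiv (R := 𝓞 ℚ)).symm ⟨p, Fact.out⟩).adicCompletion ℚ))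
  haveI : CharZero (NumberField.Place.Completion (Sum.inr ((Rat.HeightOneSpectrum.primesEquiv (R := 𝓞 ℚ)).symm ⟨p, Fact.out⟩) : NumberField.Place ℚ)) := LocalField.charZero_adicCompletion ((Rat.HeightOneSpectrum.primesEquiv (R := 𝓞 ℚ)).symm ⟨p, Fact.out⟩)
  letI : Algebra ℚ_[p] (NumberField.Place.Completion (Sum.inr ((Rat.HeightOneSpectrum.primesEquiv (R := 𝓞 ℚ)).symm ⟨p, Fact.out⟩) : NumberField.Place ℚ)) :=
    LocalField.adicCompletionPadicAlgebra ((Rat.HeightOneSpectrum.primesEquiv (R := 𝓞 ℚ)).symm ⟨p, Fact.out⟩) p ((natCast_mem_asIdeal_iff_eq_primesEquiv_symm _ (Fact.out : p.Prime)).mpr rfl)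
  haveI : Fact (¬ IsUnit ((p : ℕ) : integerC (NumberField.Place.Completion (Sum.inr ((Rat.HeightOneSpectrum.primesEquiv (R := 𝓞 ℚ)).symm ⟨p, Fact.out⟩) : NumberField.Place ℚ)))) :=
    ⟨not_isUnit_natCast_integerC (show valuation (NumberField.Place.Completion (Sum.inr ((Rat.HeightOneSpectrum.primesEquiv (R := 𝓞 ℚ)).symm ⟨p, Fact.out⟩) : NumberField.Place ℚ)) ((p : ℕ) : (NumberField.Place.Completion (Sum.inr ((Rat.HeightOneSpectrum.primesEquiv (R := 𝓞 ℚ)).symm ⟨p, Fact.out⟩) : NumberField.Place ℚ))) < 1 from LocalField.valuation_adicCompletion_natCast_lt_one ((Rat.HeightOneSpectrum.primesEquiv (R := 𝓞 ℚ)).symm ⟨p, Fact.out⟩) p ((natCast_mem_asIdeal_iff_eq_primesEquiv_symm _ (Fact.out : p.Prime)).mpr rfl))⟩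
  haveI := isAdicComplete_integerC_natCast (show valuation (NumberField.Place.Completion (Sum.inr ((Rat.HeightOneSpectrum.primesEquiv (R := 𝓞 ℚ)).symm ⟨p, Fact.out⟩) : NumberField.Place ℚ)) ((p : ℕ) : (NumberField.Place.Completion (Sum.inr ((Rat.HeightOneSpectrum.primesEquiv (R := 𝓞 ℚ)).symm ⟨p, Fact.out⟩) : NumberField.Place ℚ))) < 1 from LocalField.valuation_adicCompletion_natCast_lt_one ((Rat.HeightOneSpectrum.primesEquiv (R := 𝓞 ℚ)).symm ⟨p, Fact.out⟩) p ((natCast_mem_asIdeal_iff_eq_primesEquiv_symm _ (Fact.out : p.Prime)).mpr rfl))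
  -- the tree's `ℚ`-algebra structure on `ℚ_v` pinned, as in `AdmissibleZetaClassBody`
  letI : Algebra ℚ (NumberField.Place.Completion (Sum.inr ((Rat.HeightOneSpectrum.primesEquiv (R := 𝓞 ℚ)).symm ⟨p, Fact.out⟩) : NumberField.Place ℚ)) := NumberField.Place.instAlgebraCompletion (Sum.inr ((Rat.HeightOneSpectrum.primesEquiv (R := 𝓞 ℚ)).symm ⟨p, Fact.out⟩) : NumberField.Place ℚ)
  ∃ (N : ℕ) (_ : NeZero N) (f : CuspForm (Gamma0 N) 2) (_ : IsNewformOf W f)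
    (ι : (n : ℕ) → (CyclotomicField n ℚ →+* ℂ)) (q : ℚ)
    (Λ : ∀ (k : ℕ) (r : Finset (HeightOneSpectrum (𝓞 ℚ))),
      H1 (tateRep W p) (cycSubgroup p k r) →ₗ[ℤ_[p]] ℚ_[p] ⊗[ℚ] CyclotomicField (cycLevel p k r) ℚ),
    -- (R0) = (A0): the constant of the value law is non-zero (and rational: `q : ℚ`)
    q ≠ 0 ∧
    -- (R1) = (A1) ∧ (A2) VERBATIM: the value functional IS the dual exponential in a Tate-duality-normalised coordinate `d`
    (∃ d, DefinedExpStarBody W p f d ι ((q : ℚ) : ℝ) Λ ∧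
      ∀ a : (NumberField.Place.Completion (Sum.inr ((Rat.HeightOneSpectrum.primesEquiv (R := 𝓞 ℚ)).symm ⟨p, Fact.out⟩) : NumberField.Place ℚ)),
        (∃ η : contOneCocycles ρT.toTopRep, expStarCoord W (show valuation (NumberField.Place.Completion (Sum.inr ((Rat.HeightOneSpectrum.primesEquiv (R := 𝓞 ℚ)).symm ⟨p, Fact.out⟩) : NumberField.Place ℚ)) ((p : ℕ) : (NumberField.Place.Completion (Sum.inr ((Rat.HeightOneSpectrum.primesEquiv (R := 𝓞 ℚ)).symm ⟨p, Fact.out⟩) : NumberField.Place ℚ))) < 1 from LocalField.valuation_adicCompletion_natCast_lt_one ((Rat.HeightOneSpectrum.primesEquiv (R := 𝓞 ℚ)).symm ⟨p, Fact.out⟩) p ((natCast_mem_asIdeal_iff_eq_primesEquiv_symm _ (Fact.out : p.Prime)).mpr rfl)) d η = a) ↔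
          ∀ Q : (W.baseChange ℚ_[p]).toAffine.Point,
            ‖(Padic.adicCompletionEquiv (𝓞 ℚ) ⟨p, Fact.out⟩).symm
                (show ((Rat.HeightOneSpectrum.primesEquiv (R := 𝓞 ℚ)).symm ⟨p, Fact.out⟩).adicCompletion ℚ from a) * padicLogLocal W p Q‖ ≤ 1) ∧
    -- (R2) = (A3)-∀gauge: for EVERY admissible gauge, THE family with these values EXISTS
    (∀ (c d₁ a : ℤ) (A : ℕ) (d' : ℤ),
      0 < A → Int.gcd c (6 * p * A) = 1 → Int.gcd d₁ (6 * p * N) = 1 → (d₁ : ℤ) * d' ≡ 1 [ZMOD (A : ℤ)] →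
      ratCuspFactor f true c d₁ a A d' ≠ 0 →
        ∃ (z : ∀ (k : ℕ) (r : (cyclotomicLevelsRat p (badPlaces c d₁ A N)).Ideals),
            H1 (tateRep W p) ((cyclotomicLevelsRat p (badPlaces c d₁ A N)).level k r.1))
          (x : ∀ (k : ℕ) (r : (cyclotomicLevelsRat p (badPlaces c d₁ A N)).Ideals),
            CyclotomicField (cycLevel p k r.1) ℚ),
          ZetaBody W p f ι ((q : ℚ) : ℝ) Λ c d₁ a A z x) ∧
    -- (R3a)(R3b) = the scalars `q⁻` (Manin minus generator) and `ϖ` (period ratio) ONLY — (R3c) `0 ≤ v_p(ϖ/(q·q⁻))` REMOVED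
    ∃ (qm perRatio : ℚ),
      0 < qm ∧ AddSubgroup.closure (Set.range (ratMinusSymbol f)) = AddSubgroup.zmultiples qm ∧
      perRatio ≠ 0 ∧ plusPeriod f = ((perRatio : ℚ) : ℝ) * W.realPeriodRat


/-- `F•′` CLOSED over the structure facts of `T_pW` (tree theorems `module_free/finite_tateModule_holds`), exactly as
`MemberRealisation` closes `MemberRealisationBody`. [cite: Kato2004Asterisque, Thm. 12.5 (1) (p. 221)] -/
def MemberRealisationPrint (W : WeierstrassCurve ℚ) [W.IsElliptic] [W.IsGloballyMinimal] (p : ℕ) [Fact p.Prime]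
    [ContinuousSMul ℤ_[p] (W.tateModule p)] : Prop :=
  letI : Module.Free ℤ_[p] (W.tateModule p) := W.module_free_tateModule_holds p
  letI : Module.Finite ℤ_[p] (W.tateModule p) := W.module_finite_tateModule_holds p
  MemberRealisationPrintBody W p

/-! ## §3 `F•₇′`: THE NAMED PRINT FACT of the cell vote (class `𝒞₇`, `p = 7`, member form `∃ W′ ~ W`) -/

/-- **Kato 2004 at the member of a `𝒞₇` class (`F•₇′`; cell `bsd-cm` vote V-E2, D962; ruling D973).**  For every elliptic curve
`W/ℚ` (globally minimal model) in the class `𝒞₇` — CM (`W.HasCM`) with CM field `ℚ(√−7)` (`cmFieldDiscrOfJ W.j = −7`), analytic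
rank `1`, good ordinary reduction at `2`, and every bad prime `q ≠ 7` split in the CM field; this conjunction IS the Summits-side
predicate `X12.ClassCSeven W` unfolded — there is a globally minimal elliptic curve `W′/ℚ` ISOGENOUS to `W` over `ℚ` (Kato's member
`W_K`, `T₇W_K ≅ V_{ℤ₇}(f)(1)`) carrying `MemberRealisationPrint W′ 7`: Kato's `p`-adic zeta elements of the newform `f` of the class,
for `p = 7`, in EVERY admissible gauge, with values the dual exponential of the `L`-values in a Tate-normalised coordinate and a
rational non-zero constant (Thm. 12.5 (1) with (8.1.3), Prop. 8.12, Ex. 13.3, read at `T = V_{O_λ}(f)(1)`, §13.12), together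
with the Manin minus generator and the period ratio.  Printed for the member lattice only — hence `∃ W′`, never `∀ W` (Wuthrich
2014, pp. 391, 394).  The instance line is the (E2) stub's own idiom (`TateModule.continuousSMul_padicInt`).  No `_holds`.
[cite: Kato2004Asterisque, Thm. 12.5 (1) (p. 221), (8.1.3) (p. 180), Prop. 8.12 (p. 186), Thm. 9.7 (p. 189), Ex. 13.3 (p. 225), §13.12 (p. 231), §13.14 (p. 234)]
[cite: Wuthrich2014, p. 391 (the Λ-module Z at the lattice T) and p. 394 (semistability cannot be dropped)] -/
def kato2004_classCSeven_memberRealisationPrint : Prop :=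
  ∀ (W : WeierstrassCurve ℚ) [W.IsElliptic] [W.IsGloballyMinimal] [Fact (Nat.Prime 7)],
    (W.HasCM ∧ cmFieldDiscrOfJ W.j = -7 ∧ W.analyticRank = 1 ∧ GoodOrd W 2 ∧
      ∀ (q : ℕ) [Fact q.Prime], q ≠ 7 → ¬ Good W q → CMSplit W q) →
    ∃ (W' : WeierstrassCurve ℚ) (_ : W'.IsElliptic) (_ : W'.IsGloballyMinimal), IsIsogenous W W' ∧
      letI : ContinuousSMul ℤ_[7] (W'.tateModule 7) := TateModule.continuousSMul_padicInt
      MemberRealisationPrint W' 7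

end Literature.NumberTheory.EllipticCurves.Kato2004

end
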